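import Summits.QuantumFields.BalabanUV.T4Continuum.Spine.NE2.RegularGaugeFieldWaveCurvature
import Summits.QuantumFields.BalabanUV.T4Continuum.Spine.NE2.AdjointFieldRegularity

/-!
# T⁴ programme, spine node NE2 (U1a) — THE CURVED WITNESS, PART 3: `Ad ∘ V ≡ 1`, NON-FLATNESS, AND THE ONE-BINDER (3.26)-SHAPE END ON A BACKGROUND WITH `Δ′ ≠ 0`
# (cell `pub-balaban-gaps`, seat ne2 gen 3, file 5c; companions `Spine/NE2/RegularGaugeFieldWave`, `…WaveCurvature`, `Spine/NE2/AdjointFieldRegularity`)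

§1: the wave is central, so `Ad ∘ V ≡ 1` (**`adRep_cwave`**) and node NE3's `LocalRate` on `regClass₂ (Ad ∘ V)` holds with `C = 0` (`PrincipalB9Rate.localRate_one`); its
`(μ₀, ν₀)`-plaquettes are NOT flat for `ν₀ ≠ μ₀`, `θ ≠ 0` (**`plaqHol_cwave_ne_one`**), so (3.10)'s `Δ′` is genuinely present.  §2: **`balaban326_rate_cwave`** — the one-binder
END `AdjointFieldRegularity.balaban326_rate_of_regularGaugeField` FIRES for the wave (`|θ| ≤ 1`, `M_{μ₀} ≥ 7`): its regularity binder (`regularSites_cwave`), its NE3 binder and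
its field-strength consistency (`Fstr_cwave_consistent`) are DISCHARGED; displayed remain only the smallness of `θ` against `η ≤ etaStar` and the ONE threshold (conditions on
the real parameter `θ` and the component-family constants `‖symL‖`, `‖brkL‖`; not quantified here).
HONEST FRAMING (T4-DAG p. 1).  A TOY member of the data class (OURS); GLOBAL small field; the threshold binder is displayed, not discharged; asserts NOTHING about Bałaban's
minimisers or node NE3 away from this family; NE2 (U1a) NOT PROVED; spine PROVED 0/9 unchanged; NOT continuum YM / infinite volume / mass gap / Clay.  HONEST DEPENDENCY:
continuum YM on T⁴ ⇐ BetaPertH ∧ nine spine estimates (0/9 proved); BetaPertH ⇐ (D1) ∧ (D4) ∧ CAP+tail; G-an2-4 gates asym, D1 and NE2/3/4.  No `sorry`, no `def`.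
-/

noncomputable section

open scoped BigOperators ComplexConjugate Matrix Real

namespace Summit.QuantumFields.BalabanUV.T4Continuum.NE2.RegularGaugeFieldWaveEnd

open scoped Kronecker Matrix.Norms.L2Operator
open Literature.MathematicalPhysics.QuantumFieldTheory.Balaban1983to89.B5Prop11Plancherel (Tor fine unitVec Cst Cst_nonneg)
open Literature.MathematicalPhysics.QuantumFieldTheory.Balaban1983to89.B5G183RateUnitTower (lev lev_neZero)
open Literature.MathematicalPhysics.QuantumFieldTheory.Balaban1983to89.B9AdOrthogonal (R form)
open Literature.MathematicalPhysics.QuantumFieldTheory.Balaban1983to89.T4EtaRateMin (LocalRate)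
open Summit.QuantumFields.BalabanUV.T4Continuum
open Summit.QuantumFields.BalabanUV.T4Continuum.BalabanAveragedTowerUnit (idx Qlev one_le_lev' lev_succ')
open Summit.QuantumFields.BalabanUV.T4Continuum.BalabanAveragedTowerModes (par val_par)
open Summit.QuantumFields.BalabanUV.T4Continuum.CovariantAveragingTower (TowerLimitRate)
open Summit.QuantumFields.BalabanUV.T4Continuum.CovariantBlockAveraging (QcovLev)
open Summit.QuantumFields.BalabanUV.T4Continuum.BackgroundResolventTower (Cpert)
open Summit.QuantumFields.BalabanUV.T4Continuum.KingPairingPlantedLaw (CJ)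
open Summit.QuantumFields.BalabanUV.T4Continuum.NE2FromNE3 (bgReadings)
open Summit.QuantumFields.BalabanUV.T4Continuum.RegularBackgroundTower (betaNE3 lev_pos)
open Summit.QuantumFields.BalabanUV.T4Continuum.HolonomyTowerRegular (RegularSites regClass₂)
open Summit.QuantumFields.BalabanUV.T4Continuum.LatticeCosineProfile (cang abs_cang_le cang_add abs_cang_add_one_sub_le)
open Summit.QuantumFields.BalabanUV.T4Continuum.GaugeTermScalarData (QuT)
open Summit.QuantumFields.BalabanUV.T4Continuum.RegularSiteTransporters (siteT)
open Summit.QuantumFields.BalabanUV.T4Continuum.NestedContourTransport (theta0)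
open Summit.QuantumFields.BalabanUV.T4Continuum.GramPerturbationLaw (C2gram)
open Summit.QuantumFields.BalabanUV.T4Continuum.NE2BalabanGauge (liftR)
open Summit.QuantumFields.BalabanUV.T4Continuum.NE2BalabanLayerSharp (kappaBs C2Bs)
open Summit.QuantumFields.BalabanUV.T4Continuum.NE2BalabanWiring (epsR CdeltaR)
open Summit.QuantumFields.BalabanUV.T4Continuum.NE2BalabanFinal (kappa4F C4F)
open Summit.QuantumFields.BalabanUV.T4Continuum.NE2BalabanThreshold (etaStar)
open Summit.QuantumFields.BalabanUV.T4Continuum.GaugeTermSandwichBound (projP)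
open Summit.QuantumFields.BalabanUV.T4Continuum.GaugeTermLayer (Gop)
open Summit.QuantumFields.BalabanUV.Beta.AdjointCarrierWiring (adMat adMat_apply adMat_one)
open Summit.QuantumFields.BalabanUV.Beta.AdjointCarrierWiringEnd (CompFamily)
open Summit.QuantumFields.BalabanUV.Beta.ThinLoopHolonomy (cpxHom)
open Summit.QuantumFields.BalabanUV.T4Continuum.NE2.AdjointFieldInstance (adRep adRep_apply)
open Summit.QuantumFields.BalabanUV.T4Continuum.NE2.DeltaPrimeOperator
open Summit.QuantumFields.BalabanUV.T4Continuum.NE2.DictionaryB0 (principalB9)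
open Summit.QuantumFields.BalabanUV.T4Continuum.NE2.DeltaPrimeSecondOrder (kappaDP CDP)
open Summit.QuantumFields.BalabanUV.T4Continuum.NE2.PrincipalB9Rate (localRate_one)
open Summit.QuantumFields.BalabanUV.T4Continuum.NE2.DeltaPrimeFieldStrength (Fstr symL brkL)
open Summit.QuantumFields.BalabanUV.T4Continuum.NE2.AdjointFieldRegularity (balaban326_rate_of_regularGaugeField)
open Summit.QuantumFields.BalabanUV.T4Continuum.NE2.RegularGaugeFieldWave
open Summit.QuantumFields.BalabanUV.T4Continuum.NE2.RegularGaugeFieldWaveCurvature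

variable {n : Type} [Fintype n] [DecidableEq n] {d : ℕ} {ι : Type} [Fintype ι] [DecidableEq ι]

/-! ## §1 The wave is central: `Ad ∘ V ≡ 1`; the plaquettes are not flat -/

section Central

variable (L : ℕ) [NeZero L] (M : Fin d → ℕ) [hM : ∀ μ, NeZero (M μ)]
variable {c : ℝ} {Pc : Submodule ℝ (Matrix n n ℂ)} {e : ι → Matrix n n ℂ} (hF : CompFamily c Pc e) {θ : ℝ} {ν₀ μ₀ : Fin d}

include hF in
/-- a scalar unitary acts trivially in the adjoint representation: `Ad(e^{it}·1) = 1`. [folklore] -/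
theorem adRep_uphase (t : ℝ) : adRep hF (uphase (n := n) t) = 1 := by
  have hne : Complex.exp (Complex.I * t) ≠ 0 := Complex.exp_ne_zero _
  have hR : ∀ X : Matrix n n ℂ, R ((uphase (n := n) t : Matrix.unitaryGroup n ℂ) : Matrix n n ℂ) X = X := by
    intro X
    rw [R, uphase_coe, cexp_smul_one_inv, Matrix.smul_mul, Matrix.one_mul, Matrix.mul_smul, Matrix.mul_one, smul_smul, ← Complex.exp_add,
      neg_add_cancel, Complex.exp_zero, one_smul]
  have hmat : adMat c e (((uphase (n := n) t : Matrix.unitaryGroup n ℂ) : Matrix n n ℂ)) = 1 := by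
    rw [← adMat_one c e hF.orth]
    ext k i
    rw [adMat_apply, adMat_apply, hR, R, inv_one, Matrix.one_mul, Matrix.mul_one]
  rw [adRep_apply, hmat, map_one]

omit [NeZero L] hM in
include hF in
/-- **`Ad ∘ V ≡ 1` FOR THE WAVE**. [folklore] -/
theorem adRep_cwave (k : ℕ) (ν : Fin d) (x : Tor (fine (lev L k) M)) : adRep hF (cwave (n := n) L M θ ν₀ μ₀ k ν x) = 1 :=
  adRep_uphase hF _

/-- **THE `(μ₀, ν₀)`-PLAQUETTES OF THE WAVE ARE NOT FLAT** at the corner `x_{μ₀} = 0` (`ν₀ ≠ μ₀`, `0 < |θ| ≤ 1`, `M_{μ₀} ≥ 7`): `U(∂p) ≠ 1`, hence `F ≠ 0` and (3.10)'s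
`Δ′` does not vanish identically for this background. [folklore] -/
theorem plaqHol_cwave_ne_one [Nonempty n] (hνμ : ν₀ ≠ μ₀) (hθ0 : θ ≠ 0) (hθ : |θ| ≤ 1) (hM7 : 7 ≤ M μ₀) (k : ℕ) (x : Tor (fine (lev L k) M))
    (hx : x μ₀ = 0) :
    plaqHol (fine (lev L k) M) (fun ν x => ((cwave (n := n) L M θ ν₀ μ₀ k ν x : Matrix.unitaryGroup n ℂ) : Matrix n n ℂ)) x μ₀ ν₀ ≠ 1 := by
  have hℓ1 : (1 : ℝ) ≤ (lev L k : ℕ) := by exact_mod_cast one_le_lev' L k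
  have hℓ : (0 : ℝ) < (lev L k : ℕ) := by linarith
  have hM0 : (0 : ℝ) < (M μ₀ : ℝ) := by exact_mod_cast Nat.pos_of_ne_zero (NeZero.ne (M μ₀))
  have hM7r : (7 : ℝ) ≤ (M μ₀ : ℝ) := by exact_mod_cast hM7
  have hm2 : 2 ≤ fine (lev L k) M μ₀ := le_trans (by omega) (le_trans hM7 (Nat.le_mul_of_pos_left _ (one_le_lev' L k)))
  have hmR : ((fine (lev L k) M μ₀ : ℕ) : ℝ) = ((lev L k : ℕ) : ℝ) * (M μ₀ : ℝ) := by simp only [fine]; push_cast; ring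
  have hπ := Real.pi_pos
  rw [plaqHol_cwave]
  have hsgn : sgn2 ν₀ μ₀ μ₀ ν₀ = 1 := by
    unfold sgn2; rw [if_pos ⟨rfl, rfl⟩, if_neg (fun h => hνμ h.2), sub_zero]
  rw [hsgn, one_mul]
  -- the phase `D = (θ/c)(cos h − 1)` is non-zero and smaller than `2π` in modulus
  set h : ℝ := 2 * π / ((fine (lev L k) M μ₀ : ℕ) : ℝ) with hh
  have hD : Dstep L M θ μ₀ k x = θ / (lev L k : ℕ) * (Real.cos h - 1) := by
    rw [Dstep, cang_add_one_eq hm2, hx, ZMod.val_zero]; simp [cang, hh]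
  have hh0 : 0 < h := by positivity
  have hhπ : h < 2 * π := by
    rw [hh, div_lt_iff₀ (by rw [hmR]; positivity), hmR]
    have h1 : (1 : ℝ) < ((lev L k : ℕ) : ℝ) * (M μ₀ : ℝ) := by nlinarith
    nlinarith
  have hcos : Real.cos h - 1 < 0 := by
    have hne : Real.cos h ≠ 1 := fun h1 => hh0.ne' ((Real.cos_eq_one_iff_of_lt_of_lt (by linarith) hhπ).mp h1)
    have hle := Real.cos_le_one h
    have hlt : Real.cos h < 1 := lt_of_le_of_ne hle hne
    linarith
  have hDne : Dstep L M θ μ₀ k x ≠ 0 := by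
    rw [hD]; exact mul_ne_zero (div_ne_zero hθ0 hℓ.ne') hcos.ne
  have hDsmall : |Dstep L M θ μ₀ k x| < 2 * π := by
    rw [hD, abs_mul, abs_div, Nat.abs_cast]
    have h2 : |Real.cos h - 1| ≤ 2 := by
      rw [abs_le]; constructor <;> linarith [Real.neg_one_le_cos h, Real.cos_le_one h]
    calc |θ| / ((lev L k : ℕ) : ℝ) * |Real.cos h - 1| ≤ 1 / 1 * 2 := by gcongr
      _ < 2 * π := by linarith [Real.pi_gt_three]
  intro hcontra
  -- `exp(iD)·1 = 1` forces `exp(iD) = 1`, i.e. `D ∈ 2πℤ`, contradicting `0 < |D| < 2π`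
  have hentry := congrFun (congrFun hcontra (Classical.arbitrary n)) (Classical.arbitrary n)
  rw [Matrix.smul_apply, Matrix.one_apply_eq, smul_eq_mul, mul_one] at hentry
  obtain ⟨m, hm⟩ := Complex.exp_eq_one_iff.mp hentry
  have hreal : Dstep L M θ μ₀ k x = m * (2 * π) := by
    have := congrArg Complex.im hm
    simp at this
    linarith [this]
  rcases lt_trichotomy m 0 with hneg | hzero | hpos
  · have : (m : ℝ) ≤ -1 := by exact_mod_cast Int.le_sub_one_of_lt hneg
    have : Dstep L M θ μ₀ k x ≤ -(2 * π) := by rw [hreal]; nlinarith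
    linarith [abs_lt.mp hDsmall]
  · exact hDne (by rw [hreal, hzero]; simp)
  · have : (1 : ℝ) ≤ m := by exact_mod_cast hpos
    have : 2 * π ≤ Dstep L M θ μ₀ k x := by rw [hreal]; nlinarith
    linarith [abs_lt.mp hDsmall]

end Central

/-! ## §2 The one-binder END fires for the wave -/

section Rate

variable (L : ℕ) [NeZero L] (M : Fin d → ℕ) [hM : ∀ μ, NeZero (M μ)] (a : ℝ) (ha : 0 < a)
variable {c : ℝ} {Pc : Submodule ℝ (Matrix n n ℂ)} {e : ι → Matrix n n ℂ} (hF : CompFamily c Pc e) (θ : ℝ) (ν₀ μ₀ : Fin d)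

include ha in
/-- **THE ONE-BINDER (3.26)-SHAPE RATE END ON A CURVED BACKGROUND.**  For the transverse `U(1)`-phase wave (`|θ| ≤ 1`, `M_{μ₀} ≥ 7`) the regularity binder
(`regularSites_cwave`), node NE3's binder (`Ad ∘ V ≡ 1`, `localRate_one`) and the field-strength consistency (`Fstr_cwave_consistent`) of
`AdjointFieldRegularity.balaban326_rate_of_regularGaugeField` are DISCHARGED; displayed remain the smallness of `θ` against `η ≤ etaStar` and the ONE threshold (conditions on the
real parameter `θ` and the component-family constants; not quantified here).  For `ν₀ ≠ μ₀`, `θ ≠ 0` the background is NOT flat (`plaqHol_cwave_ne_one`). [folklore] -/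
theorem balaban326_rate_cwave [Nonempty n] [Nonempty ι] (hL : 2 ≤ L) (hd : 1 ≤ d) (hθ : |θ| ≤ 1) (hM7 : 7 ≤ M μ₀) {a' : ℝ} (ha' : 0 < a')
    {η : ℝ} (hαη : 2 * |θ| ≤ η) (hβη : 2 * (2 * π * |θ| / (M μ₀ : ℝ)) ≤ η) (hη : η ≤ etaStar ι d a a')
    (hthr : (kappaBs ι d a (2 * |θ|) (2 * (2 * π * |θ| / (M μ₀ : ℝ)))
        (a * (epsR ι d (2 * |θ|) * (2 + epsR ι d (2 * |θ|)) * Cst d a)) (kappa4F d a a' (2 * |θ|) (2 * (2 * π * |θ| / (M μ₀ : ℝ))))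
      + (d : ℝ) ^ 2 * ((2 * (2 * (2 * π * |θ| / (M μ₀ : ℝ))) + 2 * (2 * |θ|) ^ 2) * Cst d a))
      + kappaDP d a (‖symL c e‖ * (2 * (2 * π * |θ| / (M μ₀ : ℝ)) + 2 * |θ| ^ 2) ^ 2 / 2) (‖brkL c e‖ * (2 * (2 * π * |θ| / (M μ₀ : ℝ)) + 2 * |θ| ^ 2)) < 1) :
    ∃ K C₂ : ℝ, TowerLimitRate (fun k => Qlev L M k ⊗ₖ (1 : Matrix ι ι ℂ)) ((L : ℝ) ^ d)
      (fun k => (principalB9 (fine (lev L k) M) ((lev L k : ℕ) : ℂ) (fun ν x => adRep hF (cwave (n := n) L M θ ν₀ μ₀ k ν x))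
          (projP (fine (lev L k) M)
            (Gop L M (fun k ν x => adRep hF (cwave (n := n) L M θ ν₀ μ₀ k ν x))
              (QuT L M ι (siteT L M (fun k ν x => adRep hF (cwave (n := n) L M θ ν₀ μ₀ k ν x)))) a' k)
            (QuT L M ι (siteT L M (fun k ν x => adRep hF (cwave (n := n) L M θ ν₀ μ₀ k ν x))) k))
        + (a : ℂ) • (((((lev L k : ℕ) : ℂ) ^ d) • (QcovLev L M (liftR L M (fun k ν x => adRep hF (cwave (n := n) L M θ ν₀ μ₀ k ν x))) k)ᴴ)
            * QcovLev L M (liftR L M (fun k ν x => adRep hF (cwave (n := n) L M θ ν₀ μ₀ k ν x))) k)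
        + deltaPrime (fine (lev L k) M) (lev L k) c e (fun ν x => ((cwave (n := n) L M θ ν₀ μ₀ k ν x : Matrix.unitaryGroup n ℂ) : Matrix n n ℂ)))⁻¹)
      (Cpert K (2 * d * Cst d a) (CJ d a) C₂ 0 1) ((L : ℝ)⁻¹) := by
  have hM3 : 3 ≤ M μ₀ := le_trans (by norm_num) hM7
  have h1 : ∀ k ν x, adRep hF (cwave (n := n) L M θ ν₀ μ₀ k ν x) = 1 := adRep_cwave L M hF
  have hNE3 : LocalRate (bgReadings L M (regClass₂ L M (fun k ν x => adRep hF (cwave (n := n) L M θ ν₀ μ₀ k ν x)))) 0 ((L : ℝ)⁻¹) := by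
    simp only [h1]; exact localRate_one L M le_rfl (inv_nonneg.mpr (Nat.cast_nonneg _))
  exact ⟨_, _, balaban326_rate_of_regularGaugeField L M hF (cwave (n := n) L M θ ν₀ μ₀) a ha hL hd (regularSites_cwave L M hM3) le_rfl hNE3 ha'
    hαη hβη hη (by positivity) (Fstr_cwave_consistent L M hθ hM7) hthr⟩

end Rate

end Summit.QuantumFields.BalabanUV.T4Continuum.NE2.RegularGaugeFieldWaveEnd

end
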